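import Summits.KontsevichZagierPeriods.KontsevichZagierPeriods.Theorems.HeckeMultiplicityOneManinStokesTileInverse

/-!
# `ManinStokes` (stmt-KontsevichZagierPeriods-5277): the edge `C` in the coordinate `u`, and the
# integrand `G = (ω/dj) ∘ ψ` on the closed lower half plane

Support file (prover-owned, `--supports stmt-KontsevichZagierPeriods-5277`).

* the line `C`: derivative of `t ↦ j(1/2 + it)` (real), `image_kleinJ_ofComplex_half_re_Ioi` (onto `(−∞, 0)`),
  `tileInv_kleinJ_ofComplex_half`, and `integrableOn_djQuot_tileInv_C` — **`G` is absolutely integrable on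
  `(−∞, 0)`** for a cusp function `φ` (substitution `u = re j(1/2 + it)`, bound `2π ‖φ(1/2 + it)‖`,
  exponential decay `IsCuspFunction.integrableOn_ray`);
* `continuousOn_djQuot_tileInv` — `G` is continuous on `{im u ≤ 0} ∖ {0, 1728}`;
* `differentiableOn_djQuot_tileInv`, `hasDerivAt_djQuot_tileInv` — `G` is holomorphic on `{im u < 0}`.

References: M. Kontsevich, D. Zagier, *Periods* (2001), §3.4; J. E. Cremona, *Algorithms for modular
elliptic curves* (1997), §2.10. No definitions, no named facts.
-/

noncomputable section

open scoped MatrixGroups ModularForm Modular Manifold Topology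
open CongruenceSubgroup Complex Set Filter MeasureTheory ModularForm
open UpperHalfPlane hiding I
open Literature.NumberTheory.EllipticCurves Literature.NumberTheory.EllipticCurves.ModularForms

namespace Summit.KontsevichZagierPeriods.HeckeMultiplicityOne.ManinStokes

/-! ### The edge `C` in the coordinate `u`: the substitution `u = re j(1/2 + it)` -/

/-- The derivative of `t ↦ j(1/2 + it)`: `j'(1/2 + it) · i`. [folklore] -/
theorem hasDerivAt_kleinJ_ofComplex_half {t : ℝ} (ht : 0 < t) :
    HasDerivAt (fun s : ℝ => kleinJ (ofComplex ((1 / 2 : ℂ) + s * I)))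
      (deriv (kleinJ ∘ ofComplex) ((1 / 2 : ℂ) + t * I) * I) t := by
  have hd : DifferentiableAt ℂ (kleinJ ∘ ofComplex) ((1 / 2 : ℂ) + t * I) :=
    differentiableOn_kleinJ.differentiableAt
      (UpperHalfPlane.isOpen_upperHalfPlaneSet.mem_nhds (im_half_add_mul_I_pos ht))
  have h1 : HasDerivAt (fun s : ℝ => (1 / 2 : ℂ) + s * I) (1 * I) t :=
    (((hasDerivAt_id (t : ℂ)).comp_ofReal).mul_const I).const_add _
  rw [one_mul] at h1
  exact hd.hasDerivAt.comp t h1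

/-- The derivative of `t ↦ j(1/2 + it)` is real. [folklore] -/
theorem deriv_kleinJ_half_mul_I_im {t : ℝ} (ht : 0 < t) :
    (deriv (kleinJ ∘ ofComplex) ((1 / 2 : ℂ) + t * I) * I).im = 0 := by
  have him : HasDerivAt (fun s : ℝ => (kleinJ (ofComplex ((1 / 2 : ℂ) + s * I))).im)
      (deriv (kleinJ ∘ ofComplex) ((1 / 2 : ℂ) + t * I) * I).im t :=
    (Complex.imCLM.hasFDerivAt).comp_hasDerivAt t (hasDerivAt_kleinJ_ofComplex_half ht)
  have h0 : HasDerivAt (fun s : ℝ => (kleinJ (ofComplex ((1 / 2 : ℂ) + s * I))).im) 0 t := by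
    refine (hasDerivAt_const t (0 : ℝ)).congr_of_eventuallyEq ?_
    filter_upwards [isOpen_Ioi.mem_nhds (show t ∈ Ioi 0 from ht)] with s hs
    exact kleinJ_ofComplex_half_im hs
  exact him.unique h0

/-- `t ↦ re j(1/2 + it)` has derivative `re (j'(1/2 + it) i)`. [folklore] -/
theorem hasDerivAt_kleinJ_ofComplex_half_re {t : ℝ} (ht : 0 < t) :
    HasDerivAt (fun s : ℝ => (kleinJ (ofComplex ((1 / 2 : ℂ) + s * I))).re)
      (deriv (kleinJ ∘ ofComplex) ((1 / 2 : ℂ) + t * I) * I).re t :=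
  (Complex.reCLM.hasFDerivAt).comp_hasDerivAt t (hasDerivAt_kleinJ_ofComplex_half ht)

/-- `|re (j'(1/2 + it) i)| = ‖j'(1/2 + it)‖`. [folklore] -/
theorem abs_deriv_kleinJ_half_re {t : ℝ} (ht : 0 < t) :
    |(deriv (kleinJ ∘ ofComplex) ((1 / 2 : ℂ) + t * I) * I).re| =
      ‖deriv (kleinJ ∘ ofComplex) ((1 / 2 : ℂ) + t * I)‖ := by
  set w := deriv (kleinJ ∘ ofComplex) ((1 / 2 : ℂ) + t * I) * I with hw
  have hw' : w = ((w.re : ℝ) : ℂ) :=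
    Complex.ext (by simp) (by rw [Complex.ofReal_im, hw, deriv_kleinJ_half_mul_I_im ht])
  have h1 : |w.re| = ‖w‖ := by
    conv_rhs => rw [hw']
    rw [Complex.norm_real, Real.norm_eq_abs]
  rw [h1, hw, norm_mul, Complex.norm_I, mul_one]

/-- **The open line `C` maps onto `(−∞, 0)`**: `re j(1/2 + it)`, `t > √3/2`, takes every negative value
exactly once. [folklore] -/
theorem image_kleinJ_ofComplex_half_re_Ioi :
    (fun t : ℝ => (kleinJ (ofComplex ((1 / 2 : ℂ) + t * I))).re) '' Ioi (Real.sqrt 3 / 2) = Iio 0 := by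
  have hanti := strictAntiOn_kleinJ_ofComplex_half_re
  ext u
  constructor
  · rintro ⟨t, ht, rfl⟩
    have := hanti (self_mem_Ici) (Set.mem_Ici.mpr (le_of_lt (Set.mem_Ioi.mp ht))) ht
    simp only at this
    rwa [kleinJ_half_sqrt_three_re] at this
  · intro hu
    obtain ⟨t, ht, htu⟩ := exists_kleinJ_ofComplex_half_re_eq (le_of_lt hu)
    refine ⟨t, (show Real.sqrt 3 / 2 ≤ t from ht).lt_of_ne ?_, htu⟩
    rintro rfl
    rw [kleinJ_half_sqrt_three_re] at htu
    exact (ne_of_lt hu) htu.symm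

/-- `j(1/2 + it)` equals the real number `re j(1/2 + it)`. [folklore] -/
theorem kleinJ_ofComplex_half_eq_re {t : ℝ} (ht : 0 < t) :
    kleinJ (ofComplex ((1 / 2 : ℂ) + t * I)) = ((kleinJ (ofComplex ((1 / 2 : ℂ) + t * I))).re : ℂ) :=
  Complex.ext (by simp) (by rw [Complex.ofReal_im, kleinJ_ofComplex_half_im ht])

/-- The inverse `ψ` at the points of the line `C`: `ψ (re j(1/2 + it)) = 1/2 + it` (`t ≥ √3/2`). [folklore] -/
theorem tileInv_kleinJ_ofComplex_half {ψ : ℂ → ℍ}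
    (hψ : ∀ u : ℂ, u.im ≤ 0 → ψ u ∈ {z : ℍ | z ∈ 𝒟 ∧ 0 ≤ z.re} ∧ kleinJ (ψ u) = u)
    {t : ℝ} (ht : Real.sqrt 3 / 2 ≤ t) :
    ψ ((kleinJ (ofComplex ((1 / 2 : ℂ) + t * I))).re : ℂ) = ofComplex ((1 / 2 : ℂ) + t * I) := by
  rw [← kleinJ_ofComplex_half_eq_re (lt_of_lt_of_le (by positivity) ht)]
  exact tileInv_kleinJ hψ (ofComplex_half_mem_halfFd ht)

/-- **Integrability of the `C`-edge integrand** `u ↦ djQuot φ (ψ u)` on `(−∞, 0)` for a cusp function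
`φ`: after the substitution `u = re j(1/2 + it)` the integrand has norm `≤ 2π ‖φ(1/2 + it)‖`, which is
integrable on `(√3/2, ∞)` by the exponential decay of cusp functions along vertical rays
(`IsCuspFunction.integrableOn_ray`). [folklore] -/
theorem integrableOn_djQuot_tileInv_C {ψ : ℂ → ℍ}
    (hψ : ∀ u : ℂ, u.im ≤ 0 → ψ u ∈ {z : ℍ | z ∈ 𝒟 ∧ 0 ≤ z.re} ∧ kleinJ (ψ u) = u)
    {h : ℝ} {φ : ℍ → ℂ} (hφ : IsCuspFunction h φ) :
    IntegrableOn (fun x : Fin 1 → ℝ => djQuot φ (ψ (x 0))) {x | x 0 < 0} := by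
  have hset : {x : Fin 1 → ℝ | x 0 < 0} = {x | x 0 ∈ Iio (0 : ℝ)} := rfl
  rw [hset, integrableOn_fin1_iff (fun u : ℝ => djQuot φ (ψ u)), ← image_kleinJ_ofComplex_half_re_Ioi]
  have h32 : (0 : ℝ) < Real.sqrt 3 / 2 := by positivity
  have hsub : Ioi (Real.sqrt 3 / 2) ⊆ Ioi (0 : ℝ) := fun t ht => h32.trans ht
  rw [integrableOn_image_iff_integrableOn_abs_deriv_smul measurableSet_Ioi
    (fun t ht => (hasDerivAt_kleinJ_ofComplex_half_re (hsub ht)).hasDerivWithinAt)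
    (injOn_kleinJ_ofComplex_half_re.mono Ioi_subset_Ici_self)]
  have hcongr : EqOn
      (fun t : ℝ => |(deriv (kleinJ ∘ ofComplex) ((1 / 2 : ℂ) + t * I) * I).re| •
        djQuot φ (ψ (((kleinJ (ofComplex ((1 / 2 : ℂ) + t * I))).re : ℝ) : ℂ)))
      (fun t : ℝ => |(deriv (kleinJ ∘ ofComplex) ((1 / 2 : ℂ) + t * I) * I).re| •
        djQuot φ (ofComplex ((1 / 2 : ℂ) + t * I))) (Ioi (Real.sqrt 3 / 2)) := by
    intro t ht
    simp only
    rw [tileInv_kleinJ_ofComplex_half hψ (le_of_lt ht)]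
  rw [integrableOn_congr_fun hcongr measurableSet_Ioi]
  -- continuity of the substituted integrand on the open line
  have hpt : ∀ t ∈ Ioi (Real.sqrt 3 / 2), 0 < ((1 / 2 : ℂ) + t * I).im := fun t ht =>
    im_half_add_mul_I_pos (hsub ht)
  have hφc : ContinuousOn (fun t : ℝ => φ (ofComplex ((1 / 2 : ℂ) + t * I))) (Ioi (Real.sqrt 3 / 2)) :=
    (hφ.continuousOn_comp_ofComplex).comp (by fun_prop) hpt
  have hderiv_cont : ContinuousOn (fun t : ℝ =>
      |(deriv (kleinJ ∘ ofComplex) ((1 / 2 : ℂ) + t * I) * I).re|) (Ioi (Real.sqrt 3 / 2)) := by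
    have hd : ContinuousOn (deriv (kleinJ ∘ ofComplex)) {z : ℂ | 0 < z.im} :=
      (differentiableOn_kleinJ.deriv UpperHalfPlane.isOpen_upperHalfPlaneSet).continuousOn
    exact continuous_abs.comp_continuousOn (Complex.continuous_re.comp_continuousOn
      ((hd.comp (by fun_prop) hpt).mul continuousOn_const))
  have hE : ∀ t ∈ Ioi (Real.sqrt 3 / 2),
      E₄ (ofComplex ((1 / 2 : ℂ) + t * I)) ≠ 0 ∧ E₆ (ofComplex ((1 / 2 : ℂ) + t * I)) ≠ 0 := by
    intro t ht
    have hu : (kleinJ (ofComplex ((1 / 2 : ℂ) + t * I))).re ∈ Iio (0 : ℝ) := by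
      rw [← image_kleinJ_ofComplex_half_re_Ioi]; exact ⟨t, ht, rfl⟩
    have hj := kleinJ_ofComplex_half_eq_re (hsub ht)
    constructor
    · intro h0
      obtain ⟨γ, hγ⟩ := E₄_eq_zero_iff.mp h0
      have : kleinJ (ofComplex ((1 / 2 : ℂ) + t * I)) = 0 := by rw [← hγ, kleinJ_smul, kleinJ_rho]
      rw [hj] at this
      exact (ne_of_lt hu) (by exact_mod_cast this)
    · intro h0
      obtain ⟨γ, hγ⟩ := E₆_eq_zero_iff.mp h0
      have : kleinJ (ofComplex ((1 / 2 : ℂ) + t * I)) = 1728 := by rw [← hγ, kleinJ_smul, kleinJ_I]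
      rw [hj] at this
      have h1 : (kleinJ (ofComplex ((1 / 2 : ℂ) + t * I))).re = 1728 := by exact_mod_cast this
      rw [h1] at hu
      norm_num at hu
  have hdj : ContinuousOn (fun t : ℝ => djQuot φ (ofComplex ((1 / 2 : ℂ) + t * I))) (Ioi (Real.sqrt 3 / 2)) := by
    have h4 : ContinuousOn (fun t : ℝ => E₄ (ofComplex ((1 / 2 : ℂ) + t * I))) (Ioi (Real.sqrt 3 / 2)) :=
      ((UpperHalfPlane.mdifferentiable_iff.mp (E₄ : ModularForm 𝒮ℒ 4).holo').continuousOn).comp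
        (by fun_prop) hpt
    have h6 : ContinuousOn (fun t : ℝ => E₆ (ofComplex ((1 / 2 : ℂ) + t * I))) (Ioi (Real.sqrt 3 / 2)) :=
      ((UpperHalfPlane.mdifferentiable_iff.mp (E₆ : ModularForm 𝒮ℒ 6).holo').continuousOn).comp
        (by fun_prop) hpt
    have hΔ : ContinuousOn (fun t : ℝ => ModularForm.discriminant (ofComplex ((1 / 2 : ℂ) + t * I)))
        (Ioi (Real.sqrt 3 / 2)) :=
      ((UpperHalfPlane.mdifferentiable_iff.mp CuspForm.discriminant.holo').continuousOn).comp
        (by fun_prop) hpt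
    simp only [djQuot]
    refine ((hφc.mul hΔ).neg).div ((h4.pow 2).mul h6) fun t ht => ?_
    exact mul_ne_zero (pow_ne_zero _ (hE t ht).1) (hE t ht).2
  have hcont : ContinuousOn (fun t : ℝ =>
      |(deriv (kleinJ ∘ ofComplex) ((1 / 2 : ℂ) + t * I) * I).re| •
        djQuot φ (ofComplex ((1 / 2 : ℂ) + t * I))) (Ioi (Real.sqrt 3 / 2)) :=
    hderiv_cont.smul hdj
  -- the integrable bound `2π ‖φ(1/2 + it)‖`
  have hray : IntegrableOn (fun t : ℝ => φ (ofComplex ((1 / 2 : ℂ) + t * I))) (Ioi (Real.sqrt 3 / 2)) := by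
    rw [integrableOn_Ioi_iff_integrableOn_Ioi_add]
    have h1 := hφ.integrableOn_ray (ofComplex ((1 / 2 : ℂ) + (Real.sqrt 3 / 2 : ℝ) * I))
    refine (integrableOn_congr_fun (fun t _ => ?_) measurableSet_Ioi).mp h1
    rw [coe_ofComplex_half h32]
    congr 2
    push_cast
    ring
  refine Integrable.mono' (g := fun t => 2 * Real.pi * ‖φ (ofComplex ((1 / 2 : ℂ) + t * I))‖)
    (hray.norm.const_mul _) (hcont.aestronglyMeasurable measurableSet_Ioi) ?_
  rw [ae_restrict_iff' measurableSet_Ioi]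
  refine Eventually.of_forall fun t ht => ?_
  rw [norm_smul, Real.norm_eq_abs, abs_abs, abs_deriv_kleinJ_half_re (hsub ht)]
  have key := norm_deriv_kleinJ_mul_djQuot_le (ofComplex ((1 / 2 : ℂ) + t * I)) φ
  rw [coe_ofComplex_half (hsub ht)] at key
  exact key










end Summit.KontsevichZagierPeriods.HeckeMultiplicityOne.ManinStokes
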